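import Literature.Combinatorics.Designs.LegendrePairs.GroupDevelopedCores

/-!
# Hadamard 668 census, family F5c — the NON-CYCLIC group of order 333 in the kernel

Framing: lottery ticket; floor = certified bounds/negative ranges.

Cell pub-namedobj (venture DiscreteObjects), target (H), gen 3.  `v = 333 = 3²·37` has two abelian groups: `ZMod 333`
(family F5, Legendre pairs LP(333), Ramos–Hulak–de Queiroz arXiv:2607.20765) and the non-cyclic
`G333 := (ZMod 3 × ZMod 3) × ZMod 37` (family F5c, this cell).  By the group-developed two-core plug-in
(`Literature.Combinatorics.Designs.LegendrePairs.exists_hadamard_of_legendrePairOn`, Đoković–Kotsireas 2018 §9.3 /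
Arasu–Bulutoglu–Hollon 2020 Thm 2) a Legendre pair over `G333` is a Hadamard matrix of order `668`
(`hadamard668_of_legendrePairOn_G333`) — the HIT route of family F5c; the (+) controls of the family are kernel-certified
here on the two smallest non-cyclic groups carrying Legendre pairs: `Z₃ × Z₃` (→ `H(20)`, `hadamard20_of_Z3xZ3`) and the
printed `Z₅ × Z₅` pair of Đoković–Kotsireas (→ `H(52)`, `hadamard52_of_DK_pair`).  NEGATIVE ROW (ours): no Legendre pair over
`G333` has both arrays invariant under `(v, j) ↦ (v, 4j)` (`no_legendrePairOn_G333_inv4`; census classes K15 ⊂ K19, K22,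
K23 of FAMILY-F5C.md — the automorphism classes containing `j ↦ 4j`): the `Z₃₇`-compression `e(v) = Σ_j a(v,j)` of such an
array is `a(v,0) + 18(a(v,1) + a(v,2)) ∈ {±1, ±35, ±37}`, while the compressions of a Legendre pair have squared norms
summing to `594 < 35²` (`comp_norm_add`), forcing all eighteen `e(v)², f(v)²` to be `1`, i.e. `18 = 594`.  The same
one-line mechanism is arXiv:2607.20765 Table A1 row 20 in the cyclic group (tree: `rhdq_tableA1_id20`).  The lattice
lemmas (quotient-3 obstruction, transvection/shift obstruction) are in the companion file `NonCyclicLP333Lattice.lean`;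
exhaustive two-implementation searches of the remaining classes are recorded in the cell's FAMILY-F5C.md, not here.
No `sorry`, no `native_decide`.
-/

namespace Summit.Ventures.DiscreteObjects.Hadamard

open Finset BigOperators
open Literature.Combinatorics.Designs.GoethalsSeidel (IsHadamardMatrix)
open Literature.Combinatorics.Designs.LegendrePairs (PAFOn IsPMOn LegendrePairOn CoreIdxOn twoCoreOn
  twoCoreOn_isHadamard exists_hadamard_of_legendrePairOn card_coreIdxOn pafOn_zero rowsum_sq_on pm_of_sq)

/-- the non-cyclic abelian group of order 333. -/
abbrev G333 : Type := (ZMod 3 × ZMod 3) × ZMod 37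

/-- `|G333| = 333`. -/
lemma card_G333 : Fintype.card G333 = 333 := by simp [G333, ZMod.card]

/-- **HIT route of family F5c.** A Legendre pair over the non-cyclic group `(Z₃ × Z₃) × Z₃₇` is a Hadamard matrix of order
`668` (two `G`-developed cores in the Fletcher–Gysin–Seberry array). -/
theorem hadamard668_of_legendrePairOn_G333 (a b : G333 → ℤ) (h : LegendrePairOn a b) :
    ∃ H : Matrix (CoreIdxOn G333) (CoreIdxOn G333) ℤ, IsHadamardMatrix H ∧ Fintype.card (CoreIdxOn G333) = 668 := by
  obtain ⟨H, hH, hc⟩ := exists_hadamard_of_legendrePairOn a b h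
  exact ⟨H, hH, by rw [hc, card_G333]⟩

/-! ### kernel-certified (+) controls of the non-cyclic family -/

/-- a Legendre pair over `Z₃ × Z₃` (found by exhaustive search; `486` ordered pairs with row sums `+1` exist):
`a = -1` exactly off the two coordinate axes. -/
def z3a (v : ZMod 3 × ZMod 3) : ℤ := if v.1 ≠ 0 ∧ v.2 ≠ 0 then -1 else 1
/-- … and its partner `b = -1` on `{(0,2), (1,2), (2,0), (2,1)}`. -/
def z3b (v : ZMod 3 × ZMod 3) : ℤ := if v ∈ ({(0, 2), (1, 2), (2, 0), (2, 1)} : Finset (ZMod 3 × ZMod 3)) then -1 else 1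

/-- `(z3a, z3b)` is a Legendre pair over `Z₃ × Z₃` with row sums `+1` (kernel `decide`). -/
lemma z3_legendrePairOn : LegendrePairOn z3a z3b ∧ (∑ v, z3a v = 1) ∧ (∑ v, z3b v = 1) := by
  unfold LegendrePairOn IsPMOn PAFOn z3a z3b
  decide

/-- **`H(20)` from the non-cyclic group of order 9**: the two-core matrix of `(z3a, z3b)` is a Hadamard matrix of order
`20 = 2·9 + 2`. -/
theorem hadamard20_of_Z3xZ3 : IsHadamardMatrix (twoCoreOn z3a z3b) ∧ Fintype.card (CoreIdxOn (ZMod 3 × ZMod 3)) = 20 :=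
  ⟨twoCoreOn_isHadamard z3a z3b z3_legendrePairOn.1 z3_legendrePairOn.2.1 z3_legendrePairOn.2.2,
   by rw [card_coreIdxOn]; simp [ZMod.card]⟩

/-- Đoković–Kotsireas's first printed Legendre pair in `Z₅ × Z₅ = Z₅[x]/(x²+2)` (`u + v x ↦ (u, v)`; arXiv:1801.07627 §9.3):
`X₁ = {±x, ±2x, ±(1+2x), ±(1+4x), ±(2+3x), ±(2+4x)}` (symmetric), as the `±1` array that is `-1` on `X₁`. -/
def dkX1 : Finset (ZMod 5 × ZMod 5) :=
  {(0,1), (0,4), (0,2), (0,3), (1,2), (4,3), (1,4), (4,1), (2,3), (3,2), (2,4), (3,1)}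
/-- `X₂ = {1, 3, 1+2x, 2+2x, 4+x, 4+4x, ±(1+3x), ±(3+x), ±(3+2x)}`. -/
def dkX2 : Finset (ZMod 5 × ZMod 5) :=
  {(1,0), (3,0), (1,2), (2,2), (4,1), (4,4), (1,3), (4,2), (3,1), (2,4), (3,2), (2,3)}
/-- the array `-1` on `X₁`, `+1` elsewhere. -/
def dka (v : ZMod 5 × ZMod 5) : ℤ := if v ∈ dkX1 then -1 else 1
/-- the array `-1` on `X₂`, `+1` elsewhere. -/
def dkb (v : ZMod 5 × ZMod 5) : ℤ := if v ∈ dkX2 then -1 else 1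

/-- the printed `Z₅ × Z₅` pair is a Legendre pair with row sums `+1` (kernel `decide`; re-verification of DK 2018 §9.3). -/
lemma dk_legendrePairOn : LegendrePairOn dka dkb ∧ (∑ v, dka v = 1) ∧ (∑ v, dkb v = 1) := by
  unfold LegendrePairOn IsPMOn PAFOn dka dkb dkX1 dkX2
  decide

/-- **`H(52)` from `Z₅ × Z₅`** (DK 2018 §9.3, kernel-certified): the two-core matrix of the printed pair is a Hadamard
matrix of order `52`. -/
theorem hadamard52_of_DK_pair : IsHadamardMatrix (twoCoreOn dka dkb) ∧ Fintype.card (CoreIdxOn (ZMod 5 × ZMod 5)) = 52 :=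
  ⟨twoCoreOn_isHadamard dka dkb dk_legendrePairOn.1 dk_legendrePairOn.2.1 dk_legendrePairOn.2.2,
   by rw [card_coreIdxOn]; simp [ZMod.card]⟩

/-! ### the `Z₃₇`-compression and its norm identity -/

/-- the `Z₃₇`-compression of an array on `G333`: `e(v) = Σ_j c(v, j)` (`v ∈ Z₃ × Z₃`). -/
def comp37 (c : G333 → ℤ) (v : ZMod 3 × ZMod 3) : ℤ := ∑ j : ZMod 37, c (v, j)

/-- squared norm of the compression = sum of the autocorrelations along the `Z₃₇` direction:
`Σ_v e(v)² = Σ_t PAF_c(0, t)`. -/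
lemma comp37_normsq (c : G333 → ℤ) : ∑ v, comp37 c v ^ 2 = ∑ t : ZMod 37, PAFOn c ((0 : ZMod 3 × ZMod 3), t) := by
  have hv : ∀ v : ZMod 3 × ZMod 3, comp37 c v ^ 2 = ∑ t : ZMod 37, ∑ j : ZMod 37, c (v, j) * c (v, j + t) := by
    intro v
    unfold comp37
    have h1 : ∀ j : ZMod 37, ∑ t, c (v, j) * c (v, j + t) = ∑ j', c (v, j) * c (v, j') := fun j => by
      have := Equiv.sum_comp (Equiv.addLeft j) (fun j' => c (v, j) * c (v, j'))
      simpa only [Equiv.coe_addLeft] using this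
    calc (∑ j, c (v, j)) ^ 2 = ∑ j, ∑ j', c (v, j) * c (v, j') := by rw [sq, Finset.sum_mul_sum]
      _ = ∑ j, ∑ t, c (v, j) * c (v, j + t) := Finset.sum_congr rfl fun j _ => (h1 j).symm
      _ = ∑ t, ∑ j, c (v, j) * c (v, j + t) := Finset.sum_comm
  simp_rw [hv]
  rw [Finset.sum_comm]
  refine Finset.sum_congr rfl fun t _ => ?_
  unfold PAFOn
  rw [Fintype.sum_prod_type (f := fun h : G333 => c h * c (h + ((0 : ZMod 3 × ZMod 3), t)))]
  refine Finset.sum_congr rfl fun v _ => Finset.sum_congr rfl fun j _ => ?_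
  simp only [Prod.mk_add_mk, add_zero]

/-- for a Legendre pair over `G333` the two compressions have squared norms summing to `2·333 - 2·36 = 594`. -/
lemma comp_norm_add (a b : G333 → ℤ) (h : LegendrePairOn a b) :
    ∑ v, comp37 a v ^ 2 + ∑ v, comp37 b v ^ 2 = 594 := by
  rw [comp37_normsq, comp37_normsq, ← Finset.sum_add_distrib]
  have key : ∀ t : ZMod 37, PAFOn a ((0 : ZMod 3 × ZMod 3), t) + PAFOn b ((0 : ZMod 3 × ZMod 3), t) =
      (if t = 0 then (668 : ℤ) else 0) + (-2) := by
    intro t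
    split_ifs with ht
    · subst ht
      have h0 : (((0 : ZMod 3 × ZMod 3), (0 : ZMod 37)) : G333) = 0 := rfl
      rw [h0, pafOn_zero a h.1, pafOn_zero b h.2.1, card_G333]; norm_num
    · have hne : (((0 : ZMod 3 × ZMod 3), t) : G333) ≠ 0 := by
        intro hc; apply ht; exact (Prod.mk.inj hc).2
      rw [h.2.2 _ hne]; ring
  rw [Finset.sum_congr rfl (fun t _ => key t), Finset.sum_add_distrib, Finset.sum_ite_eq', Finset.sum_const,
    Finset.card_univ, ZMod.card]
  simp

/-! ### arrays invariant under `j ↦ 4j`: the compression takes values `±1, ±35, ±37` -/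

/-- `ZMod 37 = {0} ∪ 4^ℕ ∪ 2·4^ℕ` as an explicit reindexing of sums (`4` generates the squares, `2` is a non-square). -/
lemma sum_Z37_split (f : ZMod 37 → ℤ) :
    ∑ j, f j = f 0 + ∑ k : Fin 18, f (4 ^ (k : ℕ)) + ∑ k : Fin 18, f (2 * 4 ^ (k : ℕ)) := by
  have hU : (Finset.univ : Finset (ZMod 37)) =
      {0} ∪ (Finset.univ.image fun k : Fin 18 => (4 : ZMod 37) ^ (k : ℕ)) ∪
        (Finset.univ.image fun k : Fin 18 => 2 * (4 : ZMod 37) ^ (k : ℕ)) := by decide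
  have hd1 : Disjoint ({0} : Finset (ZMod 37)) (Finset.univ.image fun k : Fin 18 => (4 : ZMod 37) ^ (k : ℕ)) := by decide
  have hd2 : Disjoint (({0} : Finset (ZMod 37)) ∪ (Finset.univ.image fun k : Fin 18 => (4 : ZMod 37) ^ (k : ℕ)))
      (Finset.univ.image fun k : Fin 18 => 2 * (4 : ZMod 37) ^ (k : ℕ)) := by decide
  have hi1 : Function.Injective fun k : Fin 18 => (4 : ZMod 37) ^ (k : ℕ) := by decide
  have hi2 : Function.Injective fun k : Fin 18 => 2 * (4 : ZMod 37) ^ (k : ℕ) := by decide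
  rw [hU, Finset.sum_union hd2, Finset.sum_union hd1, Finset.sum_singleton,
    Finset.sum_image (fun x _ y _ h => hi1 h), Finset.sum_image (fun x _ y _ h => hi2 h)]

/-- invariance under `j ↦ 4j` makes the array constant on `4^ℕ · j₀`. -/
lemma inv4_pow (c : G333 → ℤ) (hc : ∀ v j, c (v, 4 * j) = c (v, j)) (v : ZMod 3 × ZMod 3) (j₀ : ZMod 37) :
    ∀ k : ℕ, c (v, 4 ^ k * j₀) = c (v, j₀) := by
  intro k
  induction k with
  | zero => simp
  | succ k ih => rw [pow_succ, mul_comm (4 ^ k : ZMod 37) 4, mul_assoc, hc, ih]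

/-- the compression of a `(j ↦ 4j)`-invariant array: `e(v) = c(v,0) + 18 c(v,1) + 18 c(v,2)`. -/
lemma comp37_inv4 (c : G333 → ℤ) (hc : ∀ v j, c (v, 4 * j) = c (v, j)) (v : ZMod 3 × ZMod 3) :
    comp37 c v = c (v, 0) + 18 * c (v, 1) + 18 * c (v, 2) := by
  unfold comp37
  rw [sum_Z37_split]
  have h1 : ∀ k : Fin 18, c (v, 4 ^ (k : ℕ)) = c (v, 1) := fun k => by
    have := inv4_pow c hc v 1 k; rwa [mul_one] at this
  have h2 : ∀ k : Fin 18, c (v, 2 * 4 ^ (k : ℕ)) = c (v, 2) := fun k => by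
    have := inv4_pow c hc v 2 k; rwa [mul_comm] at this
  simp only [h1, h2, Finset.sum_const, Finset.card_univ, Fintype.card_fin]
  ring

/-- hence `e(v)² = 1` or `e(v)² ≥ 1225` for a `±1` array invariant under `j ↦ 4j`. -/
lemma comp37_sq_inv4 (c : G333 → ℤ) (hpm : IsPMOn c) (hc : ∀ v j, c (v, 4 * j) = c (v, j)) (v : ZMod 3 × ZMod 3) :
    comp37 c v ^ 2 = 1 ∨ 1225 ≤ comp37 c v ^ 2 := by
  rw [comp37_inv4 c hc v]
  rcases hpm (v, 0) with h0 | h0 <;> rcases hpm (v, 1) with h1 | h1 <;> rcases hpm (v, 2) with h2 | h2 <;>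
    rw [h0, h1, h2] <;> norm_num

/-- the squared norm of the compression of such an array is `9` or at least `1225`. -/
lemma comp37_normsq_inv4 (c : G333 → ℤ) (hpm : IsPMOn c) (hc : ∀ v j, c (v, 4 * j) = c (v, j)) :
    ∑ v, comp37 c v ^ 2 = 9 ∨ 1225 ≤ ∑ v, comp37 c v ^ 2 := by
  by_cases hall : ∀ v, comp37 c v ^ 2 = 1
  · left
    rw [Finset.sum_congr rfl (fun v _ => hall v)]
    simp [ZMod.card]
  · right
    push Not at hall
    obtain ⟨v, hv⟩ := hall
    have hbig : 1225 ≤ comp37 c v ^ 2 := (comp37_sq_inv4 c hpm hc v).resolve_left hv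
    calc (1225 : ℤ) ≤ comp37 c v ^ 2 := hbig
      _ ≤ ∑ w, comp37 c w ^ 2 := Finset.single_le_sum (fun w _ => sq_nonneg (comp37 c w)) (Finset.mem_univ v)

/-- **Family F5c, classes containing `j ↦ 4j` (K15, K19, K22, K23): NONE.**  No Legendre pair over the non-cyclic group
`(Z₃ × Z₃) × Z₃₇` has both arrays invariant under `(v, j) ↦ (v, 4j)`; in particular no Hadamard matrix of order 668 arises
from two `G333`-developed cores with that symmetry.  (Ours; the cyclic analogue is arXiv:2607.20765 Table A1 row 20.) -/
theorem no_legendrePairOn_G333_inv4 (a b : G333 → ℤ) (ha : ∀ v j, a (v, 4 * j) = a (v, j))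
    (hb : ∀ v j, b (v, 4 * j) = b (v, j)) : ¬ LegendrePairOn a b := by
  intro h
  have hsum := comp_norm_add a b h
  have hna := comp37_normsq_inv4 a h.1 ha
  have hnb := comp37_normsq_inv4 b h.2.1 hb
  have nna : 0 ≤ ∑ v, comp37 a v ^ 2 := Finset.sum_nonneg fun v _ => sq_nonneg _
  have nnb : 0 ≤ ∑ v, comp37 b v ^ 2 := Finset.sum_nonneg fun v _ => sq_nonneg _
  rcases hna with hna | hna <;> rcases hnb with hnb | hnb <;> linarith

end Summit.Ventures.DiscreteObjects.Hadamard
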